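import Literature.AlgebraicGeometry.HodgeTheory.TypeIIRankThreePowersHodgeClasses
import Literature.AlgebraicGeometry.HodgeTheory.TimesTypeIIStablyNondegenerateProductSpan
import HarnessLib

/-!
# Type II of quaternion rank three is stably nondegenerate (Murty / Banaszak–Gajda–Krasoń, `h = 3`): all powers `A^{M+1}`, products with ANY stably nondegenerate variety (Hazama's theorem for a type II factor, unconditional), products with CM varieties (HC_CM as a binder), the simple abelian sixfolds of type II over `ℚ`

Family `hodge`, layer `Literature/AlgebraicGeometry/HodgeTheory`. Research context: cell `pub-hodge-ring2` (HONEST FRAMING: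
research route conditional on HC_CM; not a corollary; Q11.4-sentence-2 already refuted in dim ≥ 3), Literature lane gen 82,
programme R60 «quaternion rank three», fifth file: the tree's `StablyNondegenerateTypeIIRankTwo` (gen 71) and
`TimesTypeIIStablyNondegenerateProductSpan` §5/§7 (any quaternion rank) SPECIALISED to `dim A = 6[K:ℚ]`, fed by the
unconditional `isStablyNondegenerate_of_isSimple_isTotallyIndefinite_rankThree` (`TypeIIRankThreePowersHodgeClasses`).
THEOREMS ONLY (no definition, no named fact; D-0026). §1–§3 UNCONDITIONAL; §4 displays the binder `hCM` (HC_CM, Milne's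
per-variety form; never asserted) except for `dim C ≤ 3` (unconditional); no step towards a summit statement.

PUBLISHED STATEMENTS: Gordon's survey Thm. 7.2 third case (V. K. Murty; held `paper:arxiv-alg-geom_9709030` p. 20) «`W` free
over `R` of rank `2m`, `m` odd ⟹ `Hg(A) = Lf(A)` and `Hdg(Aᵏ) = Div(Aᵏ)` for all `k ≥ 1`»; Gordon 7.5–7.6 (stably
nondegenerate ⟺ no type III and `Hg = Lf`), 7.6.2 (Hazama 1989: products); Banaszak–Gajda–Krasoń 2006 Cor. 7.19, Thm. 7.34
(held `paper:doi-10-4171-dms-4-2` pp. 67, 69); Moonen–Zarhin 1999 Thm. (3.2)(1) / Lombardo 2016 Lemma 3.4 («no type IV» × CM).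

* §1 `isStablyNondegenerate_powSucc_of_isSimple_isTotallyIndefinite_rankThree` (all powers `A^{M+1}`).
* §2 `IsStablyNondegenerate.powSucc_prod_powSucc_typeIIRankThree` (ANY stably nondegenerate `B` times `A`: all mixed powers),
  `isStablyNondegenerate_prod_iff_of_isSimple_isTotallyIndefinite_rankThree` (`B × A` is (D) iff `B` is),
  `isStablyNondegenerate_powSucc_prod_powSucc_of_typeIIRankThree` (two such factors),
  `isStablyNondegenerate_powSucc_prod_powSucc_of_typeIIRankThree_rankTwo` (rank three times rank two), the Hodge conjecture for
  everything isogenous to a power of these.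
* §3 the simple abelian SIXFOLDS OF TYPE II OVER `ℚ` (atlas `g6.II(1)`): `IsStablyNondegenerate.powSucc_prod_powSucc_sixfold_typeII_rat`.
* §4 products with a CM factor: `HC(A^{N+1} × C) ⟺ HC(C)` (unconditional), HC_CM ⟹ HC(`A^{N+1} × C`) (binder), `dim C ≤ 3`
  (unconditional).

## References

* [Gordon1997] B. B. Gordon, arXiv:alg-geom/9709030, Thm. 7.2, §7.7 Prop. 7.7.1. [cite: Gordon1997, Thm. 7.2 (arXiv:alg-geom/9709030 p. 20)]
* [Gordon1999HodgeAVSurvey] B. B. Gordon, survey, Thm. 7.5, Def. 7.6, Rem. 7.6.1, Thm. 7.6.2.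
  [cite: Gordon1999HodgeAVSurvey, Thm. 7.5 (1) and Def. 7.6]
* [BanaszakGajdaKrason2006] G. Banaszak, W. Gajda, P. Krasoń, Doc. Math. Extra Vol. Coates (2006), Cor. 7.19, Thm. 7.34.
  [cite: BanaszakGajdaKrason2006, Cor. 7.19 and Thm. 7.34]
* [Hazama1989] F. Hazama, Duke Math. J. 58 (1989) 31–37. [cite: Hazama1989, Thm. (= Gordon 7.6.2)]
* [Murty1984] V. K. Murty, Math. Ann. 268 (1984), Thm. 3.1, §3. [cite: Murty1984, Thm. 3.1 and §3]
* [MoonenZarhin1999LowDim] B. Moonen, Yu. Zarhin, Math. Ann. 315 (1999), §3 Thm. (3.2). [cite: MoonenZarhin1999LowDim, §3 Thm. (3.2)]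
* [Lombardo2016] D. Lombardo, Ann. Inst. Fourier 66 (2016), Lemma 3.4. [cite: Lombardo2016, Lemma 3.4 (p. 1229)]
* [vanGeemen1994HodgeAV] B. van Geemen, LNM 1594 (1994), Lemma 3.7. [cite: vanGeemen1994HodgeAV, Lemma 3.7]
* [Deligne2000] P. Deligne, *The Hodge conjecture* (Clay, 2000), §1. [cite: Deligne2000, §1]
-/

noncomputable section

open CategoryTheory Module NumberField

namespace Literature.AlgebraicGeometry.HodgeTheory

open Literature.AlgebraicGeometry.Motives (AbelianVariety)
open Literature.AlgebraicGeometry.ComplexMultiplication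
open Literature.AlgebraicGeometry.Milne1999
open Literature.RingTheory.CentralSimple
open Literature.NumberTheory.Automorphic (IsQuaternionAlgebra)

section TypeIIRankThree

variable {A B : AbelianVariety ℂ} {K : Type} [Field K] [NumberField K] [Algebra K A.endAlgebra]
  [IsScalarTower ℚ K A.endAlgebra] [IsQuaternionAlgebra K A.endAlgebra]

/-! ### §1 All powers are stably nondegenerate — unconditional -/

variable (A) in
/-- **All powers `A^{M+1}` of a simple type II variety of quaternion rank three are stably nondegenerate — UNCONDITIONAL** (the
iterated powers have slots over `A`, `exists_avSlots_powSucc_powSucc`;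
`AVSlots.isDivisorGenerated_of_isSimple_isTotallyIndefinite_rankThree`). [cite: Gordon1997, Thm. 7.2 (arXiv:alg-geom/9709030 p. 20)]
[cite: Gordon1999HodgeAVSurvey, Rem. 7.6.1] [cite: BanaszakGajdaKrason2006, Cor. 7.19 and Thm. 7.34] -/
theorem isStablyNondegenerate_powSucc_of_isSimple_isTotallyIndefinite_rankThree [IsTotallyReal K] (hA : A.IsSimple)
    (hind : IsTotallyIndefinite K A.endAlgebra) (hdim : A.dim = 6 * Module.finrank ℚ K) (M : ℕ) :
    IsStablyNondegenerate (A.powSucc M) := by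
  intro N
  obtain ⟨n, g, hg⟩ := exists_avSlots_powSucc_powSucc A M N
  exact hg.isDivisorGenerated_of_isSimple_isTotallyIndefinite_rankThree hA hind hdim

/-! ### §2 Products with ANY stably nondegenerate variety — unconditional (Hazama's theorem for a type II factor) -/

/-- **ANY stably nondegenerate variety times a simple type II variety of quaternion rank three — UNCONDITIONAL**: all mixed
powers `B^{M+1} × A^{N+1}` are stably nondegenerate (the second factor is stably nondegenerate by
`isStablyNondegenerate_of_isSimple_isTotallyIndefinite_rankThree`; then the tree's Hazama theorem for a type II factor,
`IsStablyNondegenerate.prod_of_isSimple_isTotallyIndefinite_right`). [cite: Hazama1989, Thm. (= Gordon 7.6.2)]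
[cite: Gordon1997, Thm. 7.2 (arXiv:alg-geom/9709030 p. 20)] [cite: MoonenZarhin1999LowDim, §3 Thm. (3.2)] -/
theorem IsStablyNondegenerate.powSucc_prod_powSucc_typeIIRankThree [IsTotallyReal K] (hB : IsStablyNondegenerate B)
    (hA : A.IsSimple) (hind : IsTotallyIndefinite K A.endAlgebra) (hdim : A.dim = 6 * Module.finrank ℚ K) (M N : ℕ) :
    IsStablyNondegenerate ((B.powSucc M).prod (A.powSucc N)) :=
  (hB.prod_of_isSimple_isTotallyIndefinite_right
    (isStablyNondegenerate_of_isSimple_isTotallyIndefinite_rankThree A hA hind hdim) hA hind).powSucc_prod_powSucc M N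

/-- `B × A` itself. [cite: Hazama1989, Thm. (= Gordon 7.6.2)] [cite: Gordon1997, Thm. 7.2 (arXiv:alg-geom/9709030 p. 20)] -/
theorem IsStablyNondegenerate.prod_typeIIRankThree [IsTotallyReal K] (hB : IsStablyNondegenerate B) (hA : A.IsSimple)
    (hind : IsTotallyIndefinite K A.endAlgebra) (hdim : A.dim = 6 * Module.finrank ℚ K) :
    IsStablyNondegenerate (B.prod A) :=
  hB.prod_of_isSimple_isTotallyIndefinite_right
    (isStablyNondegenerate_of_isSimple_isTotallyIndefinite_rankThree A hA hind hdim) hA hind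

/-- `A × B`. [cite: Hazama1989, Thm. (= Gordon 7.6.2)] [cite: Gordon1997, Thm. 7.2 (arXiv:alg-geom/9709030 p. 20)] -/
theorem IsStablyNondegenerate.typeIIRankThree_prod [IsTotallyReal K] (hB : IsStablyNondegenerate B) (hA : A.IsSimple)
    (hind : IsTotallyIndefinite K A.endAlgebra) (hdim : A.dim = 6 * Module.finrank ℚ K) :
    IsStablyNondegenerate (A.prod B) :=
  hB.prod_of_isSimple_isTotallyIndefinite_left
    (isStablyNondegenerate_of_isSimple_isTotallyIndefinite_rankThree A hA hind hdim) hA hind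

/-- **`B × A` is stably nondegenerate iff `B` is** (condition (D) is hereditary; Gordon Rem. 7.6.1 with Thm. 7.6.2).
[cite: Gordon1999HodgeAVSurvey, Rem. 7.6.1 and Thm. 7.6.2] [cite: Gordon1997, Thm. 7.2 (arXiv:alg-geom/9709030 p. 20)] -/
theorem isStablyNondegenerate_prod_iff_of_isSimple_isTotallyIndefinite_rankThree [IsTotallyReal K] (hA : A.IsSimple)
    (hind : IsTotallyIndefinite K A.endAlgebra) (hdim : A.dim = 6 * Module.finrank ℚ K) :
    IsStablyNondegenerate (B.prod A) ↔ IsStablyNondegenerate B :=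
  isStablyNondegenerate_prod_iff_of_isSimple_isTotallyIndefinite
    (isStablyNondegenerate_of_isSimple_isTotallyIndefinite_rankThree A hA hind hdim) hA hind

/-- **The Hodge conjecture for everything isogenous to a power of `B^{M+1} × A^{N+1}`**, `B` stably nondegenerate, `A` simple of
type II of quaternion rank three — UNCONDITIONAL. [cite: Hazama1989, Thm. (= Gordon 7.6.2)]
[cite: vanGeemen1994HodgeAV, Lemma 3.7] [cite: Deligne2000, §1] -/
theorem hodgeConjectureFor_of_isIsogenous_powSucc_powSucc_prod_powSucc_typeIIRankThree [IsTotallyReal K]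
    (hB : IsStablyNondegenerate B) (hA : A.IsSimple) (hind : IsTotallyIndefinite K A.endAlgebra)
    (hdim : A.dim = 6 * Module.finrank ℚ K) {X : AbelianVariety ℂ} {M N L : ℕ}
    (hX : AbelianVariety.IsIsogenous X (((B.powSucc M).prod (A.powSucc N)).powSucc L)) : HodgeConjectureFor X.dim X.X :=
  (hB.powSucc_prod_powSucc_typeIIRankThree hA hind hdim M N).hodgeConjectureFor_of_isIsogenous_powSucc hX

/-- HC(`B^{M+1} × A^{N+1}`). [cite: Hazama1989, Thm. (= Gordon 7.6.2)] [cite: Deligne2000, §1] -/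
theorem hodgeConjectureFor_powSucc_prod_powSucc_typeIIRankThree [IsTotallyReal K] (hB : IsStablyNondegenerate B)
    (hA : A.IsSimple) (hind : IsTotallyIndefinite K A.endAlgebra) (hdim : A.dim = 6 * Module.finrank ℚ K) (M N : ℕ) :
    HodgeConjectureFor ((B.powSucc M).prod (A.powSucc N)).dim ((B.powSucc M).prod (A.powSucc N)).X :=
  (hB.powSucc_prod_powSucc_typeIIRankThree hA hind hdim M N).hodgeConjectureFor

/-- **Two simple type II factors of quaternion rank three — UNCONDITIONAL**: `A^{M+1} × B^{N+1}` is stably nondegenerate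
(isogenous or not). [cite: Hazama1989, Thm. (= Gordon 7.6.2)] [cite: Gordon1997, Thm. 7.2 (arXiv:alg-geom/9709030 p. 20)] -/
theorem isStablyNondegenerate_powSucc_prod_powSucc_of_typeIIRankThree [IsTotallyReal K] (hA : A.IsSimple)
    (hind : IsTotallyIndefinite K A.endAlgebra) (hdim : A.dim = 6 * Module.finrank ℚ K) {K' : Type} [Field K']
    [NumberField K'] [IsTotallyReal K'] [Algebra K' B.endAlgebra] [IsScalarTower ℚ K' B.endAlgebra]
    [IsQuaternionAlgebra K' B.endAlgebra] (hB : B.IsSimple) (hindB : IsTotallyIndefinite K' B.endAlgebra)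
    (hdimB : B.dim = 6 * Module.finrank ℚ K') (M N : ℕ) : IsStablyNondegenerate ((A.powSucc M).prod (B.powSucc N)) :=
  (isStablyNondegenerate_of_isSimple_isTotallyIndefinite_rankThree A hA hind hdim).powSucc_prod_powSucc_typeIIRankThree hB
    hindB hdimB M N

/-- **Quaternion rank three times quaternion rank two — UNCONDITIONAL**: `A^{M+1} × B^{N+1}` for simple type II factors with
`dim A = 6[K:ℚ]`, `dim B = 4[K':ℚ]`. [cite: Hazama1989, Thm. (= Gordon 7.6.2)] [cite: MoonenZarhin1995Duke, Type II]
[cite: Gordon1997, Thm. 7.2 (arXiv:alg-geom/9709030 p. 20)] -/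
theorem isStablyNondegenerate_powSucc_prod_powSucc_of_typeIIRankThree_rankTwo [IsTotallyReal K] (hA : A.IsSimple)
    (hind : IsTotallyIndefinite K A.endAlgebra) (hdim : A.dim = 6 * Module.finrank ℚ K) {K' : Type} [Field K']
    [NumberField K'] [IsTotallyReal K'] [Algebra K' B.endAlgebra] [IsScalarTower ℚ K' B.endAlgebra]
    [IsQuaternionAlgebra K' B.endAlgebra] (hB : B.IsSimple) (hindB : IsTotallyIndefinite K' B.endAlgebra)
    (hdimB : B.dim = 4 * Module.finrank ℚ K') (M N : ℕ) : IsStablyNondegenerate ((A.powSucc M).prod (B.powSucc N)) :=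
  (isStablyNondegenerate_of_isSimple_isTotallyIndefinite_rankThree A hA hind hdim).powSucc_prod_powSucc_typeIIRankTwo hB
    hindB hdimB M N

/-- HC for everything isogenous to a power of `A^{M+1} × B^{N+1}`, two simple type II factors of quaternion rank three —
UNCONDITIONAL. [cite: Hazama1989, Thm. (= Gordon 7.6.2)] [cite: vanGeemen1994HodgeAV, Lemma 3.7] -/
theorem hodgeConjectureFor_of_isIsogenous_powSucc_powSucc_prod_powSucc_of_typeIIRankThree [IsTotallyReal K]
    {X : AbelianVariety ℂ} (hA : A.IsSimple) (hind : IsTotallyIndefinite K A.endAlgebra)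
    (hdim : A.dim = 6 * Module.finrank ℚ K) {K' : Type} [Field K'] [NumberField K'] [IsTotallyReal K']
    [Algebra K' B.endAlgebra] [IsScalarTower ℚ K' B.endAlgebra] [IsQuaternionAlgebra K' B.endAlgebra] (hB : B.IsSimple)
    (hindB : IsTotallyIndefinite K' B.endAlgebra) (hdimB : B.dim = 6 * Module.finrank ℚ K') {M N L : ℕ}
    (hX : AbelianVariety.IsIsogenous X (((A.powSucc M).prod (B.powSucc N)).powSucc L)) : HodgeConjectureFor X.dim X.X :=
  (isStablyNondegenerate_powSucc_prod_powSucc_of_typeIIRankThree hA hind hdim hB hindB hdimB M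
    N).hodgeConjectureFor_of_isIsogenous_powSucc hX

/-! ### §3 The simple abelian sixfolds of type II over `ℚ` (atlas row `g6.II(1)`) -/

/-- **ANY stably nondegenerate variety times a simple abelian SIXFOLD with `End⁰` an indefinite quaternion algebra over `ℚ` —
UNCONDITIONAL**: all mixed powers. [cite: Hazama1989, Thm. (= Gordon 7.6.2)] [cite: Gordon1997, Thm. 7.2 (arXiv:alg-geom/9709030 p. 20)] -/
theorem IsStablyNondegenerate.powSucc_prod_powSucc_sixfold_typeII_rat {S : AbelianVariety ℂ} [IsQuaternionAlgebra ℚ S.endAlgebra]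
    (hB : IsStablyNondegenerate B) (hS : S.IsSimple) (hind : IsTotallyIndefinite ℚ S.endAlgebra) (hdim : S.dim = 6)
    (M N : ℕ) : IsStablyNondegenerate ((B.powSucc M).prod (S.powSucc N)) :=
  hB.powSucc_prod_powSucc_typeIIRankThree (K := ℚ) hS hind (by rw [Module.finrank_self, mul_one]; exact hdim) M N

/-- HC for everything isogenous to a power of `B^{M+1} × S^{N+1}`, `B` stably nondegenerate, `S` a simple sixfold of type II
over `ℚ` — UNCONDITIONAL. [cite: Hazama1989, Thm. (= Gordon 7.6.2)] [cite: vanGeemen1994HodgeAV, Lemma 3.7] [cite: Deligne2000, §1] -/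
theorem hodgeConjectureFor_of_isIsogenous_powSucc_powSucc_prod_powSucc_sixfold_typeII_rat {S : AbelianVariety ℂ}
    [IsQuaternionAlgebra ℚ S.endAlgebra] (hB : IsStablyNondegenerate B) (hS : S.IsSimple)
    (hind : IsTotallyIndefinite ℚ S.endAlgebra) (hdim : S.dim = 6) {X : AbelianVariety ℂ} {M N L : ℕ}
    (hX : AbelianVariety.IsIsogenous X (((B.powSucc M).prod (S.powSucc N)).powSucc L)) : HodgeConjectureFor X.dim X.X :=
  (hB.powSucc_prod_powSucc_sixfold_typeII_rat hS hind hdim M N).hodgeConjectureFor_of_isIsogenous_powSucc hX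

/-! ### §4 Products with abelian varieties of CM type («no type IV» × CM; HC_CM only as a binder) -/

/-- **`HC(A^{N+1} × C) ⟺ HC(C)`** for a simple `A` of type II of quaternion rank three and `C` of CM type — UNCONDITIONAL
(Lombardo 2016 Lemma 3.4 / Moonen–Zarhin (3.2)(1), the tree's `hodgeConjectureFor_prod_iff_of_hasNoTypeIVFactor_of_isOfCMType`).
[cite: Lombardo2016, Lemma 3.4 (p. 1229)] [cite: MoonenZarhin1999LowDim, §3 Thm. (3.2)] [cite: Gordon1997, Thm. 7.2 (arXiv:alg-geom/9709030 p. 20)] -/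
theorem hodgeConjectureFor_powSucc_prod_iff_of_isSimple_isTotallyIndefinite_rankThree_of_isOfCMType [IsTotallyReal K]
    (hA : A.IsSimple) (hind : IsTotallyIndefinite K A.endAlgebra) (hdim : A.dim = 6 * Module.finrank ℚ K) (N : ℕ)
    {C : AbelianVariety ℂ} (hCt : Milne1999.IsOfCMType C) :
    HodgeConjectureFor ((A.powSucc N).prod C).dim ((A.powSucc N).prod C).X ↔ HodgeConjectureFor C.dim C.X := by
  rw [hodgeConjectureFor_prod_iff_of_hasNoTypeIVFactor_of_isOfCMType (A.powSucc N) C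
    ((hasNoTypeIVFactor_of_isSimple_isTotallyIndefinite hA hind).powSucc N) hCt]
  exact ⟨fun h => h.2,
    fun h => ⟨hodgeConjectureFor_powSucc_of_isSimple_isTotallyIndefinite_rankThree hA hind hdim N, h⟩⟩

/-- **HC_CM ⟹ HC(`A^{N+1} × C`)** for a simple `A` of type II of quaternion rank three and `C` of CM type — CONDITIONAL ON HC_CM
(the binder `hCM`; not a corollary of anything unconditional here). [cite: Lombardo2016, Lemma 3.4 (p. 1229)]
[cite: MoonenZarhin1999LowDim, §3 Thm. (3.2)] [cite: Deligne2000, §1] -/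
theorem hodgeConjectureFor_powSucc_prod_of_isSimple_isTotallyIndefinite_rankThree_of_cmHodgeHypothesis [IsTotallyReal K]
    (hCM : ∀ Y : AbelianVariety ℂ, Milne1999.CMHodgeHypothesisAt Y) (hA : A.IsSimple)
    (hind : IsTotallyIndefinite K A.endAlgebra) (hdim : A.dim = 6 * Module.finrank ℚ K) (N : ℕ)
    {C : AbelianVariety ℂ} (hCt : Milne1999.IsOfCMType C) :
    HodgeConjectureFor ((A.powSucc N).prod C).dim ((A.powSucc N).prod C).X :=
  hodgeConjectureFor_powSucc_prod_of_hasNoTypeIVFactor_of_cmHodgeHypothesis hCM A C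
    (hasNoTypeIVFactor_of_isSimple_isTotallyIndefinite hA hind) hCt N
    (hodgeConjectureFor_powSucc_of_isSimple_isTotallyIndefinite_rankThree hA hind hdim N)

/-- **UNCONDITIONAL: `HC(A^{N+1} × C)` for a simple `A` of type II of quaternion rank three and `C` of CM type with `dim C ≤ 3`.**
[cite: Lombardo2016, Lemma 3.4 (p. 1229)] [cite: MoonenZarhin1999LowDim, Introduction and §3 Thm. (3.2)] -/
theorem hodgeConjectureFor_powSucc_prod_of_isSimple_isTotallyIndefinite_rankThree_of_isOfCMType_of_dim_le_three
    [IsTotallyReal K] (hA : A.IsSimple) (hind : IsTotallyIndefinite K A.endAlgebra)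
    (hdim : A.dim = 6 * Module.finrank ℚ K) (N : ℕ) {C : AbelianVariety ℂ} (hCt : Milne1999.IsOfCMType C)
    (hC3 : C.dim ≤ 3) : HodgeConjectureFor ((A.powSucc N).prod C).dim ((A.powSucc N).prod C).X :=
  (hodgeConjectureFor_powSucc_prod_iff_of_isSimple_isTotallyIndefinite_rankThree_of_isOfCMType hA hind hdim N hCt).2
    (hodgeConjectureFor_of_dim_le_three_holds hC3 Motives.AbelianVariety.isSmoothProjective_holds)

end TypeIIRankThree

end Literature.AlgebraicGeometry.HodgeTheory

end
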